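import Literature.Analysis.FluidPDE.NewtonGradCorrectorLp
import Literature.Analysis.FluidPDE.HelmholtzAnnihilator
import Literature.Analysis.FluidPDE.WholeSpaceIBP
import Literature.Analysis.FunctionSpaces.MollificationLp
import Literature.Analysis.FunctionSpaces.HolderNormProofs
import Literature.Analysis.FluidPDE.MollifiedSolenoidalTest
import HarnessLib

/-!
# Divergence-free `L³` fields are `L³`-limits of divergence-free fields in `L² ∩ L³`

Analysis/FluidPDE proof file (theorems only). For the construction of local Leray solutions with
`L³` data by approximation (Jia–Šverák 2013, §2, Remarks after Def. 1: "In our situation with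
initial data `u₀` in `L³` we can follow [Calderón, Rusin–Šverák] or see section 4", where Leray
solutions with data in `L³` arise as limits of solutions whose data are in addition of finite
energy) one needs: **every weakly divergence-free `u₀ ∈ L³(ℝ³)` is the `L³`-limit of weakly
divergence-free fields `aₖ ∈ L² ∩ L³`.** This file proves it by mollification and a divergence-free
truncation:

1. the mollification `ρ_ε ⋆ u` of a locally integrable weakly divergence-free field is smooth and
   classically divergence free (the tree's `contDiff_normed_convolution_of_locallyIntegrable`,
   `isDivFree_normed_convolution_of_isWeaklyDivFree`, `MollifiedSolenoidalTest.lean`);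
2. the truncation at scale `R` of a smooth divergence-free `v ∈ L³`:
   `a_R = χ_R v − F_R`, `F_R = Σⱼ T_{eⱼ}[v·∇χ_R] eⱼ`, with `T_a` the first-derivative Newtonian
   potential (`newtonGradPotential`, so that `div F_R = v·∇χ_R = div(χ_R v)` by the tree's
   `Δ(Γ ⋆ f) = f`, `sum_fderiv_newtonGradPotential_apply_self`): `a_R` is `C¹`, divergence free,
   in `L² ∩ L³` (`isDivFree_divFreeTruncation`, `memLp_two_divFreeTruncation`, `memLp_three_divFreeTruncation`), and
   `‖a_R − v‖₃ ≲ ‖1_{|x|≥R} v‖₃ → 0` by the corrector estimate of `NewtonGradCorrectorLp.lean`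
   (`eLpNorm_divFreeTruncation_sub_le`, `tendsto_eLpNorm_divFreeTruncation_sub`);
3. `exists_seq_divFree_memLp_two_three_tendsto` — the approximation theorem.

## Mathlib / tree search

Tree (all used): `newtonGradPotential`, `contDiff_one_newtonGradPotential`,
`sum_fderiv_newtonGradPotential_apply_self` (`NewtonGradientPotential`);
`eLpNorm_three_newtonGradPotential_le`, `memLp_two/three_newtonGradPotential`
(`NewtonGradCorrectorLp`); `cutoff`, `contDiff_cutoff`, `cutoff_eq_one/zero`,
`exists_norm_fderiv_cutoff_le`, `divergence_smul_apply`,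
`VectorCalculus.IsDivFree.isWeaklyDivFree_holds` (`WholeSpaceIBP`, `VectorCalculus`);
`fderiv_convolution_lsmul_apply` (`HelmholtzAnnihilator`); `FunctionSpaces.isTestFunctionOn_normed`,
`FunctionSpaces.exists_contDiffBump_seq`, `FunctionSpaces.memLp_normed_convolution`,
`FunctionSpaces.tendsto_eLpNorm_normed_convolution_sub_self` (`Mollification*`);
`LipschitzWith.holderWith_of_enorm_le` (`HolderNormProofs`). `lean search 'DivFree.*approx|dense.*divFree|
IsWeaklyDivFree.*normed_convolution'`: nothing of this kind (2026-08-15).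

## References

* H. Jia, V. Šverák, SIAM J. Math. Anal. 45 (2013) = arXiv:1201.1592, §2, Remarks after Def. 1.
  [JiaSverak2013]
* G. P. Galdi, *An Introduction to the Mathematical Theory of the Navier–Stokes Equations*, 2nd ed.
  (2011), §III.4 (approximation of solenoidal fields; here the corrector is the Newtonian one on
  the whole space instead of Bogovskii's). [Galdi2011]
* D. Gilbarg, N. S. Trudinger (2001), Lemma 4.2. [GilbargTrudinger2001]
-/

noncomputable section

open MeasureTheory TopologicalSpace Set Function Filter Topology Metric Real
open scoped ENNReal NNReal RealInnerProductSpace Convolution ContDiff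

namespace Literature.Analysis.FluidPDE

open ContinuousLinearMap (lsmul)


/-! ### The cut-off at scale `R`, the source `g = Dχ_R(v)` and the Newtonian corrector -/

section Truncation

variable {v : EuclideanSpace ℝ (Fin 3) → EuclideanSpace ℝ (Fin 3)} {R : ℝ} {x : EuclideanSpace ℝ (Fin 3)}

/-- Inside the ball `‖x‖ < R` the cut-off is locally constant (`= 1`), so its derivative
vanishes. Duplicate of the tree's `fderiv_cutoff_eq_zero_of_lt` (`NormalisedPressureL2Bound.lean`,
same namespace, in the import closure); kept only as a deprecated alias. [folklore] -/
@[deprecated fderiv_cutoff_eq_zero_of_lt (since := "2026-08-16")]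
theorem fderiv_cutoff_eq_zero_of_norm_lt (hR : 0 < R) (hx : ‖x‖ < R) :
    fderiv ℝ (cutoff (E := EuclideanSpace ℝ (Fin 3)) R) x = 0 :=
  fderiv_cutoff_eq_zero_of_lt hR hx

/-- Outside the ball `‖x‖ > 2R` the cut-off is locally constant (`= 0`), so its derivative
vanishes. Duplicate of the tree's `fderiv_cutoff_eq_zero_of_gt` (`NormalisedPressureL2Bound.lean`);
kept only as a deprecated alias. [folklore] -/
@[deprecated fderiv_cutoff_eq_zero_of_gt (since := "2026-08-16")]
theorem fderiv_cutoff_eq_zero_of_lt_norm (hR : 0 < R) (hx : 2 * R < ‖x‖) :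
    fderiv ℝ (cutoff (E := EuclideanSpace ℝ (Fin 3)) R) x = 0 :=
  fderiv_cutoff_eq_zero_of_gt hR hx

/-- The source `g = Dχ_R(v)` of the truncation is `C¹` for a `C¹` field. [folklore] -/
theorem contDiff_truncSource (hv : ContDiff ℝ 1 v) (R : ℝ) :
    ContDiff ℝ 1 fun x => fderiv ℝ (cutoff (E := EuclideanSpace ℝ (Fin 3)) R) x (v x) :=
  ((contDiff_cutoff (n := 2) R).fderiv_right (m := 1) le_rfl).clm_apply hv

/-- The source vanishes off the annulus `R ≤ ‖x‖ ≤ 2R`. [folklore] -/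
theorem truncSource_eq_zero (hR : 0 < R) (hx : ‖x‖ < R ∨ 2 * R < ‖x‖) :
    fderiv ℝ (cutoff (E := EuclideanSpace ℝ (Fin 3)) R) x (v x) = 0 := by
  rcases hx with h | h
  · rw [fderiv_cutoff_eq_zero_of_lt hR h, zero_apply]
  · rw [fderiv_cutoff_eq_zero_of_gt hR h, zero_apply]

/-- The support of the source lies in the closed annulus, in particular in `B̄(0, 2R)`. [folklore] -/
theorem tsupport_truncSource_subset (hR : 0 < R) (v : EuclideanSpace ℝ (Fin 3) → EuclideanSpace ℝ (Fin 3)) :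
    tsupport (fun x => fderiv ℝ (cutoff (E := EuclideanSpace ℝ (Fin 3)) R) x (v x)) ⊆
      {x : EuclideanSpace ℝ (Fin 3) | R ≤ ‖x‖} ∩ closedBall (0 : EuclideanSpace ℝ (Fin 3)) (2 * R) := by
  have hcl : IsClosed ({x : EuclideanSpace ℝ (Fin 3) | R ≤ ‖x‖} ∩ closedBall (0 : EuclideanSpace ℝ (Fin 3)) (2 * R)) :=
    (isClosed_le continuous_const continuous_norm).inter isClosed_closedBall
  refine closure_minimal (fun x hx => ?_) hcl
  rw [mem_support] at hx
  by_contra hc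
  apply hx
  refine truncSource_eq_zero hR ?_
  simp only [mem_inter_iff, mem_setOf_eq, mem_closedBall, dist_zero_right, not_and_or, not_le] at hc
  exact hc

/-- The source has compact support. [folklore] -/
theorem hasCompactSupport_truncSource (hR : 0 < R) (v : EuclideanSpace ℝ (Fin 3) → EuclideanSpace ℝ (Fin 3)) :
    HasCompactSupport fun x => fderiv ℝ (cutoff (E := EuclideanSpace ℝ (Fin 3)) R) x (v x) :=
  HasCompactSupport.of_support_subset_isCompact (isCompact_closedBall 0 (2 * R))
    ((subset_tsupport _).trans ((tsupport_truncSource_subset hR v).trans inter_subset_right))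

/-- The source is Hölder continuous of exponent `1/2` (it is `C¹` with compact support, hence
Lipschitz and bounded). [folklore] -/
theorem exists_holderWith_truncSource (hv : ContDiff ℝ 1 v) (hR : 0 < R) :
    ∃ C : ℝ≥0, HolderWith C (1 / 2 : ℝ≥0) fun x => fderiv ℝ (cutoff (E := EuclideanSpace ℝ (Fin 3)) R) x (v x) := by
  set g : EuclideanSpace ℝ (Fin 3) → ℝ := fun x => fderiv ℝ (cutoff (E := EuclideanSpace ℝ (Fin 3)) R) x (v x)
  have hg : ContDiff ℝ 1 g := contDiff_truncSource hv R
  have hgc : HasCompactSupport g := hasCompactSupport_truncSource hR v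
  obtain ⟨L, hL⟩ := hg.lipschitzWith_of_hasCompactSupport hgc one_ne_zero
  obtain ⟨M, hM⟩ := hg.continuous.bounded_above_of_compact_support hgc
  have hM0 : 0 ≤ M := (norm_nonneg _).trans (hM 0)
  refine ⟨L + 2 * Real.toNNReal M, hL.holderWith_of_enorm_le (fun y => ?_) (by norm_num)⟩
  rw [← ofReal_norm, ← ENNReal.ofReal_coe_nnreal, Real.coe_toNNReal M hM0]
  exact ENNReal.ofReal_le_ofReal (hM y)

/-! #### The Newtonian corrector `F = Σⱼ T_{eⱼ}[g] eⱼ` -/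

/-- The corrector is `C¹` (each `T_{eⱼ}[g]` is, `contDiff_one_newtonGradPotential`). [folklore] -/
theorem contDiff_newtonCorrector (hv : ContDiff ℝ 1 v) (hR : 0 < R) :
    ContDiff ℝ 1 fun x => ∑ j : Fin 3,
      newtonGradPotential (EuclideanSpace.single j (1 : ℝ))
        (fun y => fderiv ℝ (cutoff (E := EuclideanSpace ℝ (Fin 3)) R) y (v y)) x •
          EuclideanSpace.single j (1 : ℝ) := by
  obtain ⟨C, hC⟩ := exists_holderWith_truncSource hv hR
  have hgc := hasCompactSupport_truncSource hR v
  exact ContDiff.sum fun j _ =>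
    (contDiff_one_newtonGradPotential _ hC (by norm_num) (by norm_num) hgc).smul contDiff_const

/-- **`div F = g`**: the divergence of the corrector is the source (`Δ(Γ ⋆ g) = g` in the form
`Σⱼ ∂ⱼ T_{eⱼ}[g] = g`, `sum_fderiv_newtonGradPotential_apply_self`). [cite: GilbargTrudinger2001, Lemma 4.2] -/
theorem divergence_newtonCorrector (hv : ContDiff ℝ 1 v) (hR : 0 < R) (x : EuclideanSpace ℝ (Fin 3)) :
    VectorCalculus.divergence (fun x => ∑ j : Fin 3,
      newtonGradPotential (EuclideanSpace.single j (1 : ℝ))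
        (fun y => fderiv ℝ (cutoff (E := EuclideanSpace ℝ (Fin 3)) R) y (v y)) x •
          EuclideanSpace.single j (1 : ℝ)) x =
      fderiv ℝ (cutoff (E := EuclideanSpace ℝ (Fin 3)) R) x (v x) := by
  obtain ⟨C, hC⟩ := exists_holderWith_truncSource hv hR
  have hgc := hasCompactSupport_truncSource hR v
  set g : EuclideanSpace ℝ (Fin 3) → ℝ := fun y => fderiv ℝ (cutoff (E := EuclideanSpace ℝ (Fin 3)) R) y (v y)
  set b := EuclideanSpace.basisFun (Fin 3) ℝ with hb
  have hbj : ∀ j, b j = EuclideanSpace.single j (1 : ℝ) := fun j => EuclideanSpace.basisFun_apply _ _ j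
  have hT : ∀ j, DifferentiableAt ℝ (newtonGradPotential (EuclideanSpace.single j (1 : ℝ)) g) x := fun j =>
    ((contDiff_one_newtonGradPotential _ hC (by norm_num) (by norm_num) hgc).differentiable one_ne_zero) x
  rw [divergence_eq_sum_inner_fderiv b]
  have hD : fderiv ℝ (fun x => ∑ j : Fin 3, newtonGradPotential (EuclideanSpace.single j (1 : ℝ)) g x •
      EuclideanSpace.single j (1 : ℝ)) x = ∑ j : Fin 3,
        (fderiv ℝ (newtonGradPotential (EuclideanSpace.single j (1 : ℝ)) g) x).smulRight
          (EuclideanSpace.single j (1 : ℝ)) := by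
    rw [fderiv_fun_sum fun j _ => (hT j).smul_const _]
    refine Finset.sum_congr rfl fun j _ => ?_
    rw [fderiv_smul_const (hT j)]
  rw [hD]
  simp only [FunLike.coe_sum, Finset.sum_apply, ContinuousLinearMap.smulRight_apply,
    inner_sum, real_inner_smul_right, hbj]
  have horth : ∀ i j : Fin 3, ⟪EuclideanSpace.single i (1 : ℝ), EuclideanSpace.single j (1 : ℝ)⟫ =
      if i = j then (1 : ℝ) else 0 := fun i j => by
    rw [← hbj, ← hbj, ← b.repr_apply_apply]
    simp [hb]
  simp_rw [horth, mul_ite, mul_one, mul_zero, Finset.sum_ite_eq, Finset.mem_univ, if_true]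
  exact sum_fderiv_newtonGradPotential_apply_self hC (by norm_num) (by norm_num) hgc x

/-! #### The truncation `a = χ_R v − F` -/

/-- The corrector lies in `L³` (each component does, `memLp_three_newtonGradPotential`). [folklore] -/
theorem memLp_three_newtonCorrector (hv : ContDiff ℝ 1 v) (hR : 0 < R) :
    MemLp (fun x => ∑ j : Fin 3,
      newtonGradPotential (EuclideanSpace.single j (1 : ℝ))
        (fun y => fderiv ℝ (cutoff (E := EuclideanSpace ℝ (Fin 3)) R) y (v y)) x •
          EuclideanSpace.single j (1 : ℝ)) 3 volume := by
  obtain ⟨C, hC⟩ := exists_holderWith_truncSource hv hR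
  have hgc := hasCompactSupport_truncSource hR v
  have hg : Continuous fun y => fderiv ℝ (cutoff (E := EuclideanSpace ℝ (Fin 3)) R) y (v y) :=
    (contDiff_truncSource hv R).continuous
  have hsupp := (tsupport_truncSource_subset hR v).trans inter_subset_right
  have key : ∀ j ∈ (Finset.univ : Finset (Fin 3)), MemLp (fun x =>
      newtonGradPotential (EuclideanSpace.single j (1 : ℝ))
        (fun y => fderiv ℝ (cutoff (E := EuclideanSpace ℝ (Fin 3)) R) y (v y)) x •
          EuclideanSpace.single j (1 : ℝ)) 3 volume := by
    intro j _
    have hT : Continuous (newtonGradPotential (EuclideanSpace.single j (1 : ℝ))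
        fun y => fderiv ℝ (cutoff (E := EuclideanSpace ℝ (Fin 3)) R) y (v y)) :=
      (contDiff_one_newtonGradPotential _ hC (by norm_num) (by norm_num) hgc).continuous
    have h := ((ContinuousLinearMap.id ℝ ℝ).smulRight (EuclideanSpace.single j (1 : ℝ))).comp_memLp'
      (memLp_three_newtonGradPotential hg hsupp hR hT.aestronglyMeasurable)
    exact h
  exact memLp_finsetSum' Finset.univ key

/-- The corrector lies in `L²` (each component does, `memLp_two_newtonGradPotential`). [folklore] -/
theorem memLp_two_newtonCorrector (hv : ContDiff ℝ 1 v) (hR : 0 < R) :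
    MemLp (fun x => ∑ j : Fin 3,
      newtonGradPotential (EuclideanSpace.single j (1 : ℝ))
        (fun y => fderiv ℝ (cutoff (E := EuclideanSpace ℝ (Fin 3)) R) y (v y)) x •
          EuclideanSpace.single j (1 : ℝ)) 2 volume := by
  obtain ⟨C, hC⟩ := exists_holderWith_truncSource hv hR
  have hgc := hasCompactSupport_truncSource hR v
  have hg : Continuous fun y => fderiv ℝ (cutoff (E := EuclideanSpace ℝ (Fin 3)) R) y (v y) :=
    (contDiff_truncSource hv R).continuous
  have hsupp := (tsupport_truncSource_subset hR v).trans inter_subset_right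
  have key : ∀ j ∈ (Finset.univ : Finset (Fin 3)), MemLp (fun x =>
      newtonGradPotential (EuclideanSpace.single j (1 : ℝ))
        (fun y => fderiv ℝ (cutoff (E := EuclideanSpace ℝ (Fin 3)) R) y (v y)) x •
          EuclideanSpace.single j (1 : ℝ)) 2 volume := by
    intro j _
    have hT : Continuous (newtonGradPotential (EuclideanSpace.single j (1 : ℝ))
        fun y => fderiv ℝ (cutoff (E := EuclideanSpace ℝ (Fin 3)) R) y (v y)) :=
      (contDiff_one_newtonGradPotential _ hC (by norm_num) (by norm_num) hgc).continuous
    have h := ((ContinuousLinearMap.id ℝ ℝ).smulRight (EuclideanSpace.single j (1 : ℝ))).comp_memLp'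
      (memLp_two_newtonGradPotential hg hsupp hR hT.aestronglyMeasurable)
    exact h
  exact memLp_finsetSum' Finset.univ key

/-- The truncated field `χ_R v` is continuous with compact support, hence in every `L^p`. [folklore] -/
theorem memLp_cutoff_smul (hv : Continuous v) (hR : 0 < R) (p : ℝ≥0∞) :
    MemLp (fun x => cutoff (E := EuclideanSpace ℝ (Fin 3)) R x • v x) p volume :=
  ((contDiff_cutoff (n := 0) R).continuous.smul hv).memLp_of_hasCompactSupport
    ((hasCompactSupport_cutoff hR).smul_right)

/-- **The truncation `a = χ_R v − F` is divergence free** for a divergence-free `C¹` field `v`: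
`div(χ v) = χ div v + Dχ(v) = g` and `div F = g`. [cite: GilbargTrudinger2001, Lemma 4.2] -/
theorem isDivFree_divFreeTruncation (hv : ContDiff ℝ 1 v) (hdiv : VectorCalculus.IsDivFree v) (hR : 0 < R) :
    VectorCalculus.IsDivFree fun x => cutoff (E := EuclideanSpace ℝ (Fin 3)) R x • v x - ∑ j : Fin 3,
      newtonGradPotential (EuclideanSpace.single j (1 : ℝ))
        (fun y => fderiv ℝ (cutoff (E := EuclideanSpace ℝ (Fin 3)) R) y (v y)) x •
          EuclideanSpace.single j (1 : ℝ) := by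
  intro x
  have hχ : DifferentiableAt ℝ (cutoff (E := EuclideanSpace ℝ (Fin 3)) R) x :=
    ((contDiff_cutoff (n := 1) R).differentiable one_ne_zero) x
  have hvx : DifferentiableAt ℝ v x := (hv.differentiable one_ne_zero) x
  have h1 : DifferentiableAt ℝ (fun x => cutoff (E := EuclideanSpace ℝ (Fin 3)) R x • v x) x := hχ.smul hvx
  have h2 : DifferentiableAt ℝ (fun x => ∑ j : Fin 3,
      newtonGradPotential (EuclideanSpace.single j (1 : ℝ))
        (fun y => fderiv ℝ (cutoff (E := EuclideanSpace ℝ (Fin 3)) R) y (v y)) x •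
          EuclideanSpace.single j (1 : ℝ)) x :=
    ((contDiff_newtonCorrector hv hR).differentiable one_ne_zero) x
  rw [divergence_sub_apply h1 h2, divergence_smul_apply hχ hvx, divergence_newtonCorrector hv hR x, hdiv x,
    mul_zero, zero_add, inner_gradient_right_eq_fderiv, sub_self]

/-- The truncation is `C¹`. [folklore] -/
theorem contDiff_divFreeTruncation (hv : ContDiff ℝ 1 v) (hR : 0 < R) :
    ContDiff ℝ 1 fun x => cutoff (E := EuclideanSpace ℝ (Fin 3)) R x • v x - ∑ j : Fin 3,
      newtonGradPotential (EuclideanSpace.single j (1 : ℝ))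
        (fun y => fderiv ℝ (cutoff (E := EuclideanSpace ℝ (Fin 3)) R) y (v y)) x •
          EuclideanSpace.single j (1 : ℝ) :=
  ((contDiff_cutoff (n := 1) R).smul hv).sub (contDiff_newtonCorrector hv hR)

/-- The truncation is weakly divergence free (it is `C¹` and divergence free). [folklore] -/
theorem isWeaklyDivFree_divFreeTruncation (hv : ContDiff ℝ 1 v) (hdiv : VectorCalculus.IsDivFree v) (hR : 0 < R) :
    IsWeaklyDivFree fun x => cutoff (E := EuclideanSpace ℝ (Fin 3)) R x • v x - ∑ j : Fin 3,
      newtonGradPotential (EuclideanSpace.single j (1 : ℝ))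
        (fun y => fderiv ℝ (cutoff (E := EuclideanSpace ℝ (Fin 3)) R) y (v y)) x •
          EuclideanSpace.single j (1 : ℝ) :=
  VectorCalculus.IsDivFree.isWeaklyDivFree_holds (isDivFree_divFreeTruncation hv hdiv hR) (contDiff_divFreeTruncation hv hR)

/-- The truncation lies in `L²`. [folklore] -/
theorem memLp_two_divFreeTruncation (hv : ContDiff ℝ 1 v) (hR : 0 < R) :
    MemLp (fun x => cutoff (E := EuclideanSpace ℝ (Fin 3)) R x • v x - ∑ j : Fin 3,
      newtonGradPotential (EuclideanSpace.single j (1 : ℝ))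
        (fun y => fderiv ℝ (cutoff (E := EuclideanSpace ℝ (Fin 3)) R) y (v y)) x •
          EuclideanSpace.single j (1 : ℝ)) 2 volume :=
  (memLp_cutoff_smul hv.continuous hR 2).sub (memLp_two_newtonCorrector hv hR)

/-- The truncation lies in `L³`. [folklore] -/
theorem memLp_three_divFreeTruncation (hv : ContDiff ℝ 1 v) (hR : 0 < R) :
    MemLp (fun x => cutoff (E := EuclideanSpace ℝ (Fin 3)) R x • v x - ∑ j : Fin 3,
      newtonGradPotential (EuclideanSpace.single j (1 : ℝ))
        (fun y => fderiv ℝ (cutoff (E := EuclideanSpace ℝ (Fin 3)) R) y (v y)) x •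
          EuclideanSpace.single j (1 : ℝ)) 3 volume :=
  (memLp_cutoff_smul hv.continuous hR 3).sub (memLp_three_newtonCorrector hv hR)

/-! #### The `L³` distance of the truncation to the field -/

/-- `(x³)^{2/3} = x²` for `x ≥ 0`. [folklore] -/
theorem rpow_three_twoThirds {x : ℝ} (hx : 0 ≤ x) : (x ^ 3) ^ (2 / 3 : ℝ) = x ^ 2 := by
  rw [show x ^ 3 = x ^ ((3 : ℕ) : ℝ) by rw [Real.rpow_natCast], ← Real.rpow_mul hx,
    show ((3 : ℕ) : ℝ) * (2 / 3) = ((2 : ℕ) : ℝ) by norm_num, Real.rpow_natCast]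

/-- `(c / R³)^{1/3} = c^{1/3} / R` for `c ≥ 0`, `R > 0`. [folklore] -/
theorem rpow_div_cube_oneThird {c : ℝ} (hc : 0 ≤ c) (hR : 0 < R) :
    (c / R ^ 3) ^ (1 / 3 : ℝ) = c ^ (1 / 3 : ℝ) / R := by
  rw [Real.div_rpow hc (by positivity), show R ^ 3 = R ^ ((3 : ℕ) : ℝ) by rw [Real.rpow_natCast],
    ← Real.rpow_mul hR.le, show ((3 : ℕ) : ℝ) * (1 / 3) = 1 by norm_num, Real.rpow_one]

/-- **The source is controlled by the tail of `v`**: `‖g‖_{L³} ≤ (C/R) ‖1_{‖x‖≥R} v‖_{L³}`, where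
`‖Dχ_R‖ ≤ C/R`. [folklore] -/
theorem eLpNorm_truncSource_le {C : ℝ} (hC : ∀ x : EuclideanSpace ℝ (Fin 3),
      ‖fderiv ℝ (cutoff (E := EuclideanSpace ℝ (Fin 3)) R) x‖ ≤ C / R) (hR : 0 < R) (hC0 : 0 ≤ C)
    (v : EuclideanSpace ℝ (Fin 3) → EuclideanSpace ℝ (Fin 3)) (p : ℝ≥0∞) :
    eLpNorm (fun x => fderiv ℝ (cutoff (E := EuclideanSpace ℝ (Fin 3)) R) x (v x)) p volume ≤
      ENNReal.ofReal (C / R) * eLpNorm ({x : EuclideanSpace ℝ (Fin 3) | R ≤ ‖x‖}.indicator v) p volume := by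
  have h := eLpNorm_le_nnreal_smul_eLpNorm_of_ae_le_mul (μ := (volume : Measure (EuclideanSpace ℝ (Fin 3))))
    (f := fun x => fderiv ℝ (cutoff (E := EuclideanSpace ℝ (Fin 3)) R) x (v x))
    (g := {x : EuclideanSpace ℝ (Fin 3) | R ≤ ‖x‖}.indicator v) (c := Real.toNNReal (C / R)) (p := p)
    (Eventually.of_forall fun x => ?_)
  · exact h
  · rw [← NNReal.coe_le_coe, NNReal.coe_mul, coe_nnnorm, coe_nnnorm, Real.coe_toNNReal _ (by positivity)]
    by_cases hx : R ≤ ‖x‖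
    · rw [indicator_of_mem (show x ∈ {x : EuclideanSpace ℝ (Fin 3) | R ≤ ‖x‖} from hx)]
      exact ((fderiv ℝ (cutoff R) x).le_opNorm (v x)).trans (mul_le_mul_of_nonneg_right (hC x) (norm_nonneg _))
    · rw [truncSource_eq_zero hR (Or.inl (not_le.1 hx)), norm_zero]
      positivity

/-- **The `L¹` mass of the source**: `∫ |g| ≤ (C/R) (2R)² V^{2/3} ‖1_{‖x‖≥R} v‖_{L³}`, `V` the volume
of the unit ball (Hölder on the annulus `R ≤ ‖x‖ ≤ 2R`). [folklore] -/
theorem lintegral_enorm_truncSource_le {C : ℝ} (hC : ∀ x : EuclideanSpace ℝ (Fin 3),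
      ‖fderiv ℝ (cutoff (E := EuclideanSpace ℝ (Fin 3)) R) x‖ ≤ C / R) (hR : 0 < R) (hC0 : 0 ≤ C)
    (hvm : AEStronglyMeasurable v volume) :
    ∫⁻ x, ‖fderiv ℝ (cutoff (E := EuclideanSpace ℝ (Fin 3)) R) x (v x)‖ₑ ≤
      ENNReal.ofReal (C / R) * ENNReal.ofReal ((2 * R) ^ 2) *
        volume (ball (0 : EuclideanSpace ℝ (Fin 3)) 1) ^ (2 / 3 : ℝ) *
          eLpNorm ({x : EuclideanSpace ℝ (Fin 3) | R ≤ ‖x‖}.indicator v) 3 volume := by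
  set S : Set (EuclideanSpace ℝ (Fin 3)) := {x | R ≤ ‖x‖} with hS
  set A : Set (EuclideanSpace ℝ (Fin 3)) := S ∩ closedBall 0 (2 * R) with hA
  have hSm : MeasurableSet S := measurableSet_le measurable_const measurable_norm
  have hAm : MeasurableSet A := hSm.inter measurableSet_closedBall
  set V : ℝ≥0∞ := volume (ball (0 : EuclideanSpace ℝ (Fin 3)) 1) with hV
  -- `|g| ≤ (C/R) 1_A |v|`
  have hpt : ∀ x, ‖fderiv ℝ (cutoff (E := EuclideanSpace ℝ (Fin 3)) R) x (v x)‖ₑ ≤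
      ENNReal.ofReal (C / R) * A.indicator (fun x => ‖v x‖ₑ) x := by
    intro x
    by_cases hx : x ∈ A
    · rw [indicator_of_mem hx, ← ofReal_norm, ← ofReal_norm, ← ENNReal.ofReal_mul (by positivity)]
      exact ENNReal.ofReal_le_ofReal
        (((fderiv ℝ (cutoff R) x).le_opNorm (v x)).trans (mul_le_mul_of_nonneg_right (hC x) (norm_nonneg _)))
    · have h0 : fderiv ℝ (cutoff (E := EuclideanSpace ℝ (Fin 3)) R) x (v x) = 0 := by
        have hx' : x ∉ tsupport fun x => fderiv ℝ (cutoff (E := EuclideanSpace ℝ (Fin 3)) R) x (v x) :=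
          fun h => hx (tsupport_truncSource_subset hR v h)
        exact image_eq_zero_of_notMem_tsupport (f := fun x => fderiv ℝ (cutoff (E := EuclideanSpace ℝ (Fin 3)) R) x (v x)) hx'
      rw [h0, enorm_zero]
      exact zero_le
  -- Hölder on `A`
  have hpq : (3 : ℝ).HolderConjugate (3 / 2) := Real.holderConjugate_iff.2 ⟨by norm_num, by norm_num⟩
  have hH := ENNReal.lintegral_mul_le_Lp_mul_Lq (volume.restrict A) hpq hvm.enorm.restrict
    (g := fun _ => (1 : ℝ≥0∞)) aemeasurable_const
  simp only [Pi.mul_apply, mul_one, ENNReal.one_rpow, lintegral_const, Measure.restrict_apply_univ, one_div,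
    one_mul] at hH
  -- the two factors
  have h3 : (∫⁻ x in A, ‖v x‖ₑ ^ (3 : ℝ)) ^ (3 : ℝ)⁻¹ ≤ eLpNorm (S.indicator v) 3 volume := by
    have e : ∫⁻ x in A, ‖v x‖ₑ ^ (3 : ℝ) ≤ ∫⁻ x, ‖S.indicator v x‖ₑ ^ (3 : ℝ) := by
      rw [← lintegral_indicator hAm]
      refine lintegral_mono fun x => ?_
      by_cases hx : x ∈ A
      · rw [indicator_of_mem hx, indicator_of_mem (inter_subset_left hx)]
      · rw [indicator_of_notMem hx]; exact zero_le
    rw [lintegral_enorm_rpow_three_eq_eLpNorm_rpow volume (S.indicator v)] at e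
    calc (∫⁻ x in A, ‖v x‖ₑ ^ (3 : ℝ)) ^ (3 : ℝ)⁻¹ ≤ (eLpNorm (S.indicator v) 3 volume ^ (3 : ℝ)) ^ (3 : ℝ)⁻¹ :=
          ENNReal.rpow_le_rpow e (by norm_num)
      _ = eLpNorm (S.indicator v) 3 volume := by
          rw [← ENNReal.rpow_mul, show (3 : ℝ) * 3⁻¹ = 1 by norm_num, ENNReal.rpow_one]
  have hvol : volume A ^ (3 / 2 : ℝ)⁻¹ ≤ ENNReal.ofReal ((2 * R) ^ 2) * V ^ (2 / 3 : ℝ) := by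
    have hA' : volume A ≤ ENNReal.ofReal ((2 * R) ^ 3) * V := by
      calc volume A ≤ volume (closedBall (0 : EuclideanSpace ℝ (Fin 3)) (2 * R)) := measure_mono inter_subset_right
        _ = ENNReal.ofReal ((2 * R) ^ 3) * V := by
            rw [Measure.addHaar_closedBall _ _ (by positivity : (0 : ℝ) ≤ 2 * R), finrank_euclideanSpace_fin]
    rw [show (3 / 2 : ℝ)⁻¹ = 2 / 3 by norm_num]
    calc volume A ^ (2 / 3 : ℝ) ≤ (ENNReal.ofReal ((2 * R) ^ 3) * V) ^ (2 / 3 : ℝ) := ENNReal.rpow_le_rpow hA' (by norm_num)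
      _ = ENNReal.ofReal ((2 * R) ^ 2) * V ^ (2 / 3 : ℝ) := by
          rw [ENNReal.mul_rpow_of_nonneg _ _ (by norm_num), ENNReal.ofReal_rpow_of_nonneg (by positivity) (by norm_num),
            rpow_three_twoThirds (by positivity)]
  calc ∫⁻ x, ‖fderiv ℝ (cutoff (E := EuclideanSpace ℝ (Fin 3)) R) x (v x)‖ₑ
      ≤ ∫⁻ x, ENNReal.ofReal (C / R) * A.indicator (fun x => ‖v x‖ₑ) x := lintegral_mono hpt
    _ = ENNReal.ofReal (C / R) * ∫⁻ x in A, ‖v x‖ₑ := by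
        rw [lintegral_const_mul' _ _ ENNReal.ofReal_ne_top, lintegral_indicator hAm]
    _ ≤ ENNReal.ofReal (C / R) * ((∫⁻ x in A, ‖v x‖ₑ ^ (3 : ℝ)) ^ (3 : ℝ)⁻¹ * volume A ^ (3 / 2 : ℝ)⁻¹) :=
        mul_le_mul' le_rfl hH
    _ ≤ ENNReal.ofReal (C / R) * (eLpNorm (S.indicator v) 3 volume * (ENNReal.ofReal ((2 * R) ^ 2) * V ^ (2 / 3 : ℝ))) :=
        mul_le_mul' le_rfl (mul_le_mul' h3 hvol)
    _ = _ := by ring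

/-- **The `L³` distance of the truncation to the field.** There is an absolute constant `K < ∞` such
that for every `C¹` field `v ∈ L³(ℝ³)` and every `R > 0`,
`‖a_R − v‖_{L³} ≤ K ‖1_{‖x‖≥R} v‖_{L³}`, `a_R = χ_R v − F_R` the divergence-free truncation
(`‖(χ_R − 1)v‖₃ ≤ ‖1_{‖x‖≥R}v‖₃`, and the corrector estimate `eLpNorm_three_newtonGradPotential_le`
with `R‖g‖₃ ≲ ‖1_{‖x‖≥R}v‖₃`, `R⁻¹‖g‖₁ ≲ ‖1_{‖x‖≥R}v‖₃`). [cite: GilbargTrudinger2001, Lemma 4.1 with (4.9)] -/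
theorem exists_const_eLpNorm_divFreeTruncation_sub_le :
    ∃ K : ℝ≥0∞, K ≠ ⊤ ∧ ∀ (v : EuclideanSpace ℝ (Fin 3) → EuclideanSpace ℝ (Fin 3)) (R : ℝ),
      ContDiff ℝ 1 v → 0 < R →
      eLpNorm (fun x => (cutoff (E := EuclideanSpace ℝ (Fin 3)) R x • v x - ∑ j : Fin 3,
        newtonGradPotential (EuclideanSpace.single j (1 : ℝ))
          (fun y => fderiv ℝ (cutoff (E := EuclideanSpace ℝ (Fin 3)) R) y (v y)) x •
            EuclideanSpace.single j (1 : ℝ)) - v x) 3 volume ≤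
        K * eLpNorm ({x : EuclideanSpace ℝ (Fin 3) | R ≤ ‖x‖}.indicator v) 3 volume := by
  obtain ⟨C, hC0, hC⟩ := exists_norm_fderiv_cutoff_le (E := EuclideanSpace ℝ (Fin 3))
  set V : ℝ≥0∞ := volume (ball (0 : EuclideanSpace ℝ (Fin 3)) 1) with hV
  have hVtop : V ≠ ⊤ := measure_ball_lt_top.ne
  set K₂ : ℝ≥0∞ := ENNReal.ofReal (6 * C) +
    ENNReal.ofReal (π⁻¹ * (C * 4 * (4 * π / (3 * 4 ^ 3)) ^ (1 / 3 : ℝ))) * V ^ (2 / 3 : ℝ) with hK₂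
  have hK₂top : K₂ ≠ ⊤ := ENNReal.add_ne_top.2 ⟨ENNReal.ofReal_ne_top,
    ENNReal.mul_ne_top ENNReal.ofReal_ne_top (ENNReal.rpow_ne_top_of_nonneg (by norm_num) hVtop)⟩
  refine ⟨1 + 3 * K₂, ENNReal.add_ne_top.2 ⟨ENNReal.one_ne_top, ENNReal.mul_ne_top (by norm_num) hK₂top⟩,
    fun v R hv hR => ?_⟩
  set S : Set (EuclideanSpace ℝ (Fin 3)) := {x | R ≤ ‖x‖} with hS
  set m : ℝ≥0∞ := eLpNorm (S.indicator v) 3 volume with hm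
  set χ : EuclideanSpace ℝ (Fin 3) → ℝ := cutoff (E := EuclideanSpace ℝ (Fin 3)) R with hχ
  set g : EuclideanSpace ℝ (Fin 3) → ℝ := fun y => fderiv ℝ (cutoff (E := EuclideanSpace ℝ (Fin 3)) R) y (v y) with hg
  set T : Fin 3 → EuclideanSpace ℝ (Fin 3) → ℝ := fun j => newtonGradPotential (EuclideanSpace.single j (1 : ℝ)) g with hT
  set F : EuclideanSpace ℝ (Fin 3) → EuclideanSpace ℝ (Fin 3) := fun x => ∑ j : Fin 3, T j x • EuclideanSpace.single j (1 : ℝ) with hF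
  -- regularity of the pieces
  obtain ⟨Cg, hCg⟩ := exists_holderWith_truncSource hv hR
  have hgc : HasCompactSupport g := hasCompactSupport_truncSource hR v
  have hgcont : Continuous g := (contDiff_truncSource hv R).continuous
  have hsupp : tsupport g ⊆ closedBall (0 : EuclideanSpace ℝ (Fin 3)) (2 * R) :=
    (tsupport_truncSource_subset hR v).trans inter_subset_right
  have hTc : ∀ j, Continuous (T j) := fun j =>
    (contDiff_one_newtonGradPotential _ hCg (by norm_num) (by norm_num) hgc).continuous
  have hvm : AEStronglyMeasurable v volume := hv.continuous.aestronglyMeasurable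
  have hχc : Continuous χ := (contDiff_cutoff (n := 0) R).continuous
  -- (1) split `a - v = (χ - 1) • v - F`
  have hsplit : (fun x => (χ x • v x - F x) - v x) = fun x => ((χ x - 1) • v x) - F x := by
    funext x; simp only [sub_smul, one_smul]; abel
  have hm1 : AEStronglyMeasurable (fun x => (χ x - 1) • v x) volume :=
    ((hχc.sub continuous_const).smul hv.continuous).aestronglyMeasurable
  have hm2 : AEStronglyMeasurable F volume :=
    (continuous_finsetSum _ fun j _ => (hTc j).smul continuous_const).aestronglyMeasurable
  have h1 : eLpNorm (fun x => (χ x • v x - F x) - v x) 3 volume ≤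
      eLpNorm (fun x => (χ x - 1) • v x) 3 volume + eLpNorm F 3 volume := by
    rw [hsplit]
    exact eLpNorm_sub_le hm1 hm2 (by norm_num)
  -- (2) `‖(χ - 1) v‖₃ ≤ m`
  have h2 : eLpNorm (fun x => (χ x - 1) • v x) 3 volume ≤ m := by
    refine eLpNorm_mono fun x => ?_
    by_cases hx : R ≤ ‖x‖
    · rw [indicator_of_mem (show x ∈ S from hx), norm_smul]
      refine mul_le_of_le_one_left (norm_nonneg _) ?_
      rw [Real.norm_eq_abs, abs_sub_comm, abs_of_nonneg (by linarith [cutoff_le_one R x])]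
      linarith [cutoff_nonneg R x]
    · rw [show χ x = 1 from cutoff_eq_one hR (le_of_lt (not_le.1 hx)), sub_self, zero_smul, norm_zero]
      exact norm_nonneg _
  -- (3) `‖F‖₃ ≤ Σⱼ ‖T j‖₃ ≤ 3 K₂ m`
  have hTj : ∀ j, eLpNorm (T j) 3 volume ≤ K₂ * m := by
    intro j
    have hb := eLpNorm_three_newtonGradPotential_le (a := EuclideanSpace.single j (1 : ℝ)) hgcont hsupp hR
    have he : ‖EuclideanSpace.single j (1 : ℝ)‖ₑ = 1 := by
      rw [← ofReal_norm]
      simp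
    rw [he, one_mul, one_mul] at hb
    have hg3 := eLpNorm_truncSource_le (hC R hR) hR hC0 v 3
    have hg1 := lintegral_enorm_truncSource_le (hC R hR) hR hC0 hvm
    set c₀ : ℝ := 4 * π / (3 * (4 * R) ^ 3) with hc₀
    have hc₀0 : 0 ≤ c₀ := by positivity
    have e1 : ENNReal.ofReal (6 * R) * (ENNReal.ofReal (C / R) * m) = ENNReal.ofReal (6 * C) * m := by
      rw [← mul_assoc, ← ENNReal.ofReal_mul (by positivity)]
      congr 2
      field_simp
    have e2 : ENNReal.ofReal π⁻¹ * (ENNReal.ofReal (C / R) * ENNReal.ofReal ((2 * R) ^ 2) * V ^ (2 / 3 : ℝ) * m) *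
        ENNReal.ofReal c₀ ^ (1 / 3 : ℝ) =
        ENNReal.ofReal (π⁻¹ * (C * 4 * (4 * π / (3 * 4 ^ 3)) ^ (1 / 3 : ℝ))) * V ^ (2 / 3 : ℝ) * m := by
      have hreal : π⁻¹ * (C * 4 * (4 * π / (3 * 4 ^ 3)) ^ (1 / 3 : ℝ)) =
          π⁻¹ * (C / R) * (2 * R) ^ 2 * c₀ ^ (1 / 3 : ℝ) := by
        have hc : c₀ = (4 * π / (3 * 4 ^ 3)) / R ^ 3 := by
          rw [hc₀]; field_simp
        rw [hc, rpow_div_cube_oneThird (by positivity) hR]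
        field_simp
        ring
      rw [hreal, ENNReal.ofReal_rpow_of_nonneg hc₀0 (by norm_num), ENNReal.ofReal_mul (by positivity),
        ENNReal.ofReal_mul (by positivity), ENNReal.ofReal_mul (by positivity)]
      ring
    calc eLpNorm (T j) 3 volume
        ≤ ENNReal.ofReal (6 * R) * eLpNorm g 3 volume +
            ENNReal.ofReal π⁻¹ * (∫⁻ y, ‖g y‖ₑ) * ENNReal.ofReal c₀ ^ (1 / 3 : ℝ) := hb
      _ ≤ ENNReal.ofReal (6 * R) * (ENNReal.ofReal (C / R) * m) +
            ENNReal.ofReal π⁻¹ * (ENNReal.ofReal (C / R) * ENNReal.ofReal ((2 * R) ^ 2) * V ^ (2 / 3 : ℝ) * m) *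
              ENNReal.ofReal c₀ ^ (1 / 3 : ℝ) :=
          add_le_add (mul_le_mul' le_rfl hg3) (mul_le_mul' (mul_le_mul' le_rfl hg1) le_rfl)
      _ = K₂ * m := by rw [e1, e2, hK₂]; ring
  have hFj : ∀ j, eLpNorm (fun x => T j x • EuclideanSpace.single j (1 : ℝ)) 3 volume ≤ K₂ * m := by
    intro j
    refine (eLpNorm_mono fun x => ?_).trans (hTj j)
    rw [norm_smul]
    simp
  have h3 : eLpNorm F 3 volume ≤ 3 * (K₂ * m) := by
    have hF' : F = ∑ j : Fin 3, fun x => T j x • EuclideanSpace.single j (1 : ℝ) := by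
      funext x; simp only [hF, Finset.sum_apply]
    rw [hF']
    refine (eLpNorm_sum_le (fun j _ => ((hTc j).smul continuous_const).aestronglyMeasurable) (by norm_num)).trans ?_
    calc ∑ j : Fin 3, eLpNorm (fun x => T j x • EuclideanSpace.single j (1 : ℝ)) 3 volume
        ≤ ∑ _j : Fin 3, K₂ * m := Finset.sum_le_sum fun j _ => hFj j
      _ = 3 * (K₂ * m) := by simp
  calc eLpNorm (fun x => (χ x • v x - F x) - v x) 3 volume
      ≤ eLpNorm (fun x => (χ x - 1) • v x) 3 volume + eLpNorm F 3 volume := h1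
    _ ≤ m + 3 * (K₂ * m) := add_le_add h2 h3
    _ = (1 + 3 * K₂) * m := by ring

end Truncation

/-! ### Tails of `L³` fields and the approximation theorem -/

section Approximation

/-- **The tail of an `L³` field vanishes at infinity**: `‖1_{‖x‖≥N} f‖_{L³} → 0` as `N → ∞`
(dominated convergence; the `L³` twin of the tree's `tendsto_lintegral_tail_zero`). [folklore] -/
theorem tendsto_eLpNorm_indicator_tail_zero {f : EuclideanSpace ℝ (Fin 3) → EuclideanSpace ℝ (Fin 3)}
    (hf : MemLp f 3 volume) :
    Tendsto (fun N : ℕ => eLpNorm ({x : EuclideanSpace ℝ (Fin 3) | (N : ℝ) ≤ ‖x‖}.indicator f) 3 volume)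
      atTop (𝓝 0) := by
  have hmeasS : ∀ N : ℕ, MeasurableSet {x : EuclideanSpace ℝ (Fin 3) | (N : ℝ) ≤ ‖x‖} := fun N =>
    measurableSet_le measurable_const measurable_norm
  -- the cubes of the norms tend to zero
  have hfin : ∫⁻ x, ‖f x‖ₑ ^ (3 : ℝ) ∂(volume : Measure (EuclideanSpace ℝ (Fin 3))) ≠ ⊤ := by
    rw [lintegral_enorm_rpow_three_eq_eLpNorm_rpow]
    exact ENNReal.rpow_ne_top_of_nonneg (by norm_num) hf.eLpNorm_ne_top
  have hmeas : ∀ N : ℕ, AEMeasurable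
      (fun x => ({x : EuclideanSpace ℝ (Fin 3) | (N : ℝ) ≤ ‖x‖}).indicator (fun x => ‖f x‖ₑ ^ (3 : ℝ)) x)
      (volume : Measure (EuclideanSpace ℝ (Fin 3))) :=
    fun N => (hf.1.enorm.pow_const _).indicator (hmeasS N)
  have h := tendsto_lintegral_of_dominated_convergence' (μ := (volume : Measure (EuclideanSpace ℝ (Fin 3))))
    (F := fun (N : ℕ) x => ({x : EuclideanSpace ℝ (Fin 3) | (N : ℝ) ≤ ‖x‖}).indicator (fun x => ‖f x‖ₑ ^ (3 : ℝ)) x)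
    (f := fun _ => 0) (fun x => ‖f x‖ₑ ^ (3 : ℝ)) hmeas
    (fun N => Eventually.of_forall fun x => indicator_le_self _ _ x) hfin
    (Eventually.of_forall fun x => ?_)
  · simp only [lintegral_zero] at h
    have hcube : ∀ N : ℕ, eLpNorm ({x : EuclideanSpace ℝ (Fin 3) | (N : ℝ) ≤ ‖x‖}.indicator f) 3 volume =
        (∫⁻ x, ({x : EuclideanSpace ℝ (Fin 3) | (N : ℝ) ≤ ‖x‖}).indicator (fun x => ‖f x‖ₑ ^ (3 : ℝ)) x) ^ (1 / 3 : ℝ) := by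
      intro N
      have e : ∫⁻ x, ({x : EuclideanSpace ℝ (Fin 3) | (N : ℝ) ≤ ‖x‖}).indicator (fun x => ‖f x‖ₑ ^ (3 : ℝ)) x =
          ∫⁻ x, ‖({x : EuclideanSpace ℝ (Fin 3) | (N : ℝ) ≤ ‖x‖}).indicator f x‖ₑ ^ (3 : ℝ) := by
        refine lintegral_congr fun x => ?_
        by_cases hx : x ∈ {x : EuclideanSpace ℝ (Fin 3) | (N : ℝ) ≤ ‖x‖}
        · rw [indicator_of_mem hx, indicator_of_mem hx]
        · rw [indicator_of_notMem hx, indicator_of_notMem hx, enorm_zero, ENNReal.zero_rpow_of_pos (by norm_num)]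
      rw [e, lintegral_enorm_rpow_three_eq_eLpNorm_rpow, ← ENNReal.rpow_mul,
        show (3 : ℝ) * (1 / 3) = 1 by norm_num, ENNReal.rpow_one]
    simp_rw [hcube]
    have h0 : (0 : ℝ≥0∞) = 0 ^ (1 / 3 : ℝ) := (ENNReal.zero_rpow_of_pos (by norm_num)).symm
    rw [h0]
    exact h.ennrpow_const (1 / 3)
  · -- eventually `N > ‖x‖`, where the indicator vanishes
    refine tendsto_const_nhds.congr' ?_
    filter_upwards [eventually_gt_atTop ⌈‖x‖⌉₊] with N hN
    rw [indicator_of_notMem]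
    simp only [mem_setOf_eq, not_le]
    exact (Nat.le_ceil ‖x‖).trans_lt (by exact_mod_cast hN)

/-- **Divergence-free `L³` fields are `L³`-limits of divergence-free `C¹` fields in `L² ∩ L³`.**
For every weakly divergence-free `u₀ ∈ L³(ℝ³)` there are `C¹`, divergence-free fields `aₖ ∈ L² ∩ L³`
with `‖aₖ − u₀‖_{L³} → 0`: mollify (`ρ_ε ⋆ u₀` is smooth, divergence free and `→ u₀` in `L³`), then
truncate with the Newtonian corrector (`a_R = χ_R v − F_R`, `‖a_R − v‖₃ ≲ ‖1_{‖x‖≥R}v‖₃ → 0`), and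
choose a diagonal sequence. [cite: JiaSverak2013, §2 Remarks after Def. 1 (data in `L³`, solutions as limits)] -/
theorem exists_seq_divFree_memLp_two_three_tendsto
    {u₀ : EuclideanSpace ℝ (Fin 3) → EuclideanSpace ℝ (Fin 3)} (hu₀ : MemLp u₀ 3 volume)
    (hdiv : IsWeaklyDivFree u₀) :
    ∃ a : ℕ → EuclideanSpace ℝ (Fin 3) → EuclideanSpace ℝ (Fin 3),
      (∀ k, ContDiff ℝ 1 (a k) ∧ VectorCalculus.IsDivFree (a k) ∧ MemLp (a k) 2 volume ∧ MemLp (a k) 3 volume) ∧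
      Tendsto (fun k => eLpNorm (a k - u₀) 3 volume) atTop (𝓝 0) := by
  obtain ⟨K, hK, hbound⟩ := exists_const_eLpNorm_divFreeTruncation_sub_le
  obtain ⟨φ, hφ0, -⟩ := FunctionSpaces.exists_contDiffBump_seq (E := EuclideanSpace ℝ (Fin 3))
  have hu₀l : LocallyIntegrable u₀ volume := hu₀.locallyIntegrable (by norm_num)
  -- the mollified fields
  set v : ℕ → EuclideanSpace ℝ (Fin 3) → EuclideanSpace ℝ (Fin 3) := fun n => (φ n).normed volume ⋆[lsmul ℝ ℝ, volume] u₀ with hv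
  have hv1 : ∀ n, ContDiff ℝ 1 (v n) := fun n => contDiff_normed_convolution_of_locallyIntegrable (φ n) hu₀l
  have hvdiv : ∀ n, VectorCalculus.IsDivFree (v n) := fun n =>
    isDivFree_normed_convolution_of_isWeaklyDivFree (φ n) hu₀l hdiv
  have hv3 : ∀ n, MemLp (v n) 3 volume := fun n => FunctionSpaces.memLp_normed_convolution (φ n) hu₀ (by norm_num)
  have hvconv : Tendsto (fun n => eLpNorm (v n - u₀) 3 volume) atTop (𝓝 0) :=
    FunctionSpaces.tendsto_eLpNorm_normed_convolution_sub_self hφ0 (by norm_num) (by norm_num) hu₀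
  -- the truncations at scale `N + 1`
  set a' : ℕ → ℕ → EuclideanSpace ℝ (Fin 3) → EuclideanSpace ℝ (Fin 3) := fun n N x =>
    cutoff (E := EuclideanSpace ℝ (Fin 3)) ((N : ℝ) + 1) x • v n x - ∑ j : Fin 3,
      newtonGradPotential (EuclideanSpace.single j (1 : ℝ))
        (fun y => fderiv ℝ (cutoff (E := EuclideanSpace ℝ (Fin 3)) ((N : ℝ) + 1)) y (v n y)) x •
          EuclideanSpace.single j (1 : ℝ) with ha'
  have hN0 : ∀ N : ℕ, (0 : ℝ) < (N : ℝ) + 1 := fun N => by positivity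
  have hdist : ∀ n, Tendsto (fun N : ℕ => eLpNorm (a' n N - v n) 3 volume) atTop (𝓝 0) := by
    intro n
    have htail := (tendsto_eLpNorm_indicator_tail_zero (hv3 n)).comp (tendsto_add_atTop_nat 1)
    have hKt : Tendsto (fun N : ℕ => K * eLpNorm ({x : EuclideanSpace ℝ (Fin 3) | ((N + 1 : ℕ) : ℝ) ≤ ‖x‖}.indicator (v n)) 3 volume)
        atTop (𝓝 0) := by
      have h := ENNReal.Tendsto.const_mul htail (Or.inr hK)
      rwa [mul_zero] at h
    refine tendsto_of_tendsto_of_tendsto_of_le_of_le tendsto_const_nhds hKt (fun N => zero_le) fun N => ?_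
    have hb := hbound (v n) ((N : ℝ) + 1) (hv1 n) (hN0 N)
    have hcast : ((N + 1 : ℕ) : ℝ) = (N : ℝ) + 1 := by push_cast; ring
    rw [hcast]
    exact hb
  -- choice of the diagonal sequence
  set ε : ℕ → ℝ≥0∞ := fun k => ((k + 1 : ℕ) : ℝ≥0∞)⁻¹ with hε
  have hεpos : ∀ k, 0 < ε k := fun k => ENNReal.inv_pos.2 (ENNReal.natCast_ne_top _)
  have hεlim : Tendsto ε atTop (𝓝 0) := ENNReal.tendsto_inv_nat_nhds_zero.comp (tendsto_add_atTop_nat 1)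
  have hn : ∀ k, ∃ n, eLpNorm (v n - u₀) 3 volume < ε k := fun k =>
    ((hvconv.eventually (gt_mem_nhds (hεpos k))).exists)
  choose nk hnk using hn
  have hN : ∀ k, ∃ N, eLpNorm (a' (nk k) N - v (nk k)) 3 volume < ε k := fun k =>
    (((hdist (nk k)).eventually (gt_mem_nhds (hεpos k))).exists)
  choose Nk hNk using hN
  refine ⟨fun k => a' (nk k) (Nk k), fun k => ⟨?_, ?_, ?_, ?_⟩, ?_⟩
  · exact contDiff_divFreeTruncation (hv1 _) (hN0 _)
  · exact isDivFree_divFreeTruncation (hv1 _) (hvdiv _) (hN0 _)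
  · exact memLp_two_divFreeTruncation (hv1 _) (hN0 _)
  · exact memLp_three_divFreeTruncation (hv1 _) (hN0 _)
  · have h2ε : Tendsto (fun k => ε k + ε k) atTop (𝓝 0) := by simpa using hεlim.add hεlim
    refine tendsto_of_tendsto_of_tendsto_of_le_of_le tendsto_const_nhds h2ε (fun k => zero_le) fun k => ?_
    have hsplit : (a' (nk k) (Nk k) - u₀) = (a' (nk k) (Nk k) - v (nk k)) + (v (nk k) - u₀) := by abel
    rw [hsplit]
    have hm1 : AEStronglyMeasurable (a' (nk k) (Nk k) - v (nk k)) volume :=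
      ((contDiff_divFreeTruncation (hv1 _) (hN0 _)).continuous.sub (hv1 _).continuous).aestronglyMeasurable
    have hm2 : AEStronglyMeasurable (v (nk k) - u₀) volume := (hv3 _).1.sub hu₀.1
    exact (eLpNorm_add_le hm1 hm2 (by norm_num)).trans (add_le_add (hNk k).le (hnk k).le)

/-- The approximants of `exists_seq_divFree_memLp_two_three_tendsto` are weakly divergence free
and bounded in `L³` along the tail — the form consumed by the limiting procedure for local Leray
solutions (`localLeray_limiting_procedure`). [folklore] -/
theorem exists_seq_isWeaklyDivFree_memLp_two_three_tendsto
    {u₀ : EuclideanSpace ℝ (Fin 3) → EuclideanSpace ℝ (Fin 3)} (hu₀ : MemLp u₀ 3 volume)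
    (hdiv : IsWeaklyDivFree u₀) :
    ∃ a : ℕ → EuclideanSpace ℝ (Fin 3) → EuclideanSpace ℝ (Fin 3),
      (∀ k, MemLp (a k) 2 volume ∧ MemLp (a k) 3 volume ∧ IsWeaklyDivFree (a k)) ∧
      Tendsto (fun k => eLpNorm (a k - u₀) 3 volume) atTop (𝓝 0) := by
  obtain ⟨a, ha, hlim⟩ := exists_seq_divFree_memLp_two_three_tendsto hu₀ hdiv
  exact ⟨a, fun k => ⟨(ha k).2.2.1, (ha k).2.2.2,
    VectorCalculus.IsDivFree.isWeaklyDivFree_holds (ha k).2.1 (ha k).1⟩, hlim⟩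

end Approximation


end Literature.Analysis.FluidPDE

end
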